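import Mathlib
import HarnessLib
import Summits.NavierStokesRegularity.NavierStokesRegularity.Theorems.TaoLadderRungTwoBreakEternalRigidityViscBddOneViscousTypeIFrontData

/-!
# Crux `TaoLadderRungTwoBreak.EternalRigidityViscBddOne` (stmt-NavierStokesRegularity-20420), stub (ω4) `stub_eternalLimitViscBdd`:
# (UA) ⟸ type I + front envelope (FE) + SUMMABLE wake calming (WC∑) — ERRATUM (same hand): (WC∑) as typed in §2 (bound for ALL `t ≥ t_a`
# with `P` summable over `ℤ`) is UNSATISFIABLE for a blow-up trajectory, so §2 is VACUOUS; proof and the repaired HALF-LIFE statements are in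
# `…EternalRigidityViscBddOneUniformActionHalfLife` (`not_summable_wakeProfile`, `uniformCriticalAction_of_halfLifeWake`); §1 lemmas stand.
MODEL lattice ODEs only (Tao 2016 §4, `m = 4`, registered vocabulary `ViscousUpTo`/`BlowsUpAt`/`TypeOne` of skeleton `85fbfe8e90eea58b`);
nothing here is a statement about the Navier–Stokes equations; no stub, crux or summit is closed (`--supports` ⟨20420⟩).
The tree's `eternalLimitViscBdd_of_frontData` derives the registered conclusion of (ω4) from `ViscousUpTo ∧ BlowsUpAt ∧ TypeOne` plus
THREE typed statements: (FE) front a=1 envelope, (WC) wake calming `Λ^{n+F}(t⋆−t_a)‖X_{n+F}(t)‖ ≤ P n` after every late anchor `t_a`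
with front shell `F`, (UA) uniform critical action `Λ^k ∫₀^{t⋆}‖X_k‖ ≤ A`.  Here (UA) is DISCHARGED when the wake profile `P` is summable
over `ℤ` (decay behind the front = calming, ahead of it = no precursor): `uniformCriticalAction_of_summableWake`, whence
(ω4) ⟸ (ω3) ∧ (FE) ∧ (WC∑) (`eternalLimitViscBdd_of_summableWake`).  Mechanism: two-sided front clock (upper from type I, tree
`frontClock_of_typeOne`; lower from (FE), tree `lowerClock_of_frontEnvelope`) ⟹ along dyadic anchors `s_j = t⋆ − T/2^j` a front shell
recurs at most `D+1` times, `D = log(K₁/m₁)/log 2` (`sum_le_of_sparse_fibers`); (WC) at `s_j` gives block action `≤ P(k−F_j)/2`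
(`intervalIntegral_le_sum_of_anchored`); the head `[0,t₀]` costs `≤ C t₀/(t⋆−t₀)`; bounded partial integrals of a non-negative
continuous function give integrability on `[0,t⋆)` (`integrableOn_Ico_of_intervalIntegral_le`).
HONEST LABEL: bookkeeping (§2 vacuous, see ERRATUM above); (FE), (WC), (ω3), (ω4), ⟨20420⟩ and every NS statement remain OPEN; rung 0. -/

noncomputable section

-- the summit and its single sub-problem share the name (CONVENTIONS §1)
set_option linter.dupNamespace false

open Set Filter Topology MeasureTheory
open Literature.Analysis.FluidPDE Literature.Analysis.FluidPDE.TaoCascade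
open Summit.NavierStokesRegularity.NavierStokesRegularity.Theorems.BlowupRigidityOne
open Summit.NavierStokesRegularity.NavierStokesRegularity.Theorems.MinimalViscousBlowup.ThresholdRay
open Summit.NavierStokesRegularity.NavierStokesRegularity.Theorems.EternalRigidityViscBddOne.Birth
open Summit.NavierStokesRegularity.NavierStokesRegularity.Theorems.EternalRigidityViscBddOne.CriticalRate
open Summit.NavierStokesRegularity.NavierStokesRegularity.Theorems.EternalRigidityViscBddOne.CriticalFront
open Summit.NavierStokesRegularity.NavierStokesRegularity.Theorems.EternalRigidityViscBddOne.FrontClock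
open Summit.NavierStokesRegularity.NavierStokesRegularity.Theorems.EternalRigidityViscBddOne.ViscousLawLimit

namespace Summit.NavierStokesRegularity.NavierStokesRegularity.Theorems.EternalRigidityViscBddOne.UniformAction

/-- **Dyadic block bound.**  If `f` is continuous on `[t₀, t⋆)` and after every anchor `s ∈ [t₀,t⋆)` it obeys
`f(t)(t⋆ − s) ≤ G(s)` for `t ∈ [s, t⋆)`, then along the dyadic anchors `s_j = t⋆ − (t⋆−t₀)/2^j` one has
`∫_{t₀}^{s_J} f ≤ ½ Σ_{j<J} G(s_j)` (block `[s_j, s_{j+1}]` has length `(t⋆ − s_j)/2`). [folklore] -/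
theorem intervalIntegral_le_sum_of_anchored {f G : ℝ → ℝ} {t₀ tStar : ℝ} (ht : t₀ < tStar)
    (hf : ContinuousOn f (Ico t₀ tStar))
    (hG : ∀ s : ℝ, t₀ ≤ s → s < tStar → ∀ t : ℝ, s ≤ t → t < tStar → f t * (tStar - s) ≤ G s) (J : ℕ) :
    ∫ t in t₀..(tStar - (tStar - t₀) / 2 ^ J), f t ≤
      (1 / 2) * ∑ j ∈ Finset.range J, G (tStar - (tStar - t₀) / 2 ^ j) := by
  have hT0 : 0 < tStar - t₀ := by linarith
  have hs_lt : ∀ j : ℕ, tStar - (tStar - t₀) / 2 ^ j < tStar := fun j => by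
    have : 0 < (tStar - t₀) / 2 ^ j := by positivity
    linarith
  have hs_ge : ∀ j : ℕ, t₀ ≤ tStar - (tStar - t₀) / 2 ^ j := fun j => by
    have h1 : (tStar - t₀) / 2 ^ j ≤ tStar - t₀ := div_le_self hT0.le (one_le_pow₀ (by norm_num))
    linarith
  have hmono : ∀ j : ℕ, tStar - (tStar - t₀) / 2 ^ j ≤ tStar - (tStar - t₀) / 2 ^ (j + 1) := fun j => by
    have h1 : (tStar - t₀) / 2 ^ (j + 1) ≤ (tStar - t₀) / 2 ^ j :=
      div_le_div_of_nonneg_left hT0.le (by positivity) (pow_le_pow_right₀ (by norm_num) (Nat.le_succ j))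
    linarith
  have hii : ∀ a b : ℝ, t₀ ≤ a → a ≤ b → b < tStar → IntervalIntegrable f volume a b := fun a b ha hab hb =>
    (hf.mono fun x hx => ⟨ha.trans hx.1, lt_of_le_of_lt hx.2 hb⟩).intervalIntegrable_of_Icc hab
  induction J with
  | zero => simp
  | succ J ih =>
    have hint1 : IntervalIntegrable f volume t₀ (tStar - (tStar - t₀) / 2 ^ J) :=
      hii _ _ le_rfl (hs_ge J) (hs_lt J)
    have hint2 : IntervalIntegrable f volume (tStar - (tStar - t₀) / 2 ^ J)
        (tStar - (tStar - t₀) / 2 ^ (J + 1)) := hii _ _ (hs_ge J) (hmono J) (hs_lt (J + 1))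
    rw [← intervalIntegral.integral_add_adjacent_intervals hint1 hint2, Finset.sum_range_succ, mul_add]
    refine add_le_add ih ?_
    have hpos : 0 < (tStar - t₀) / 2 ^ J := by positivity
    have hbound : ∀ t ∈ Icc (tStar - (tStar - t₀) / 2 ^ J) (tStar - (tStar - t₀) / 2 ^ (J + 1)),
        f t ≤ G (tStar - (tStar - t₀) / 2 ^ J) / ((tStar - t₀) / 2 ^ J) := by
      intro t ht
      have htT : t < tStar := lt_of_le_of_lt ht.2 (hs_lt (J + 1))
      have h := hG _ (hs_ge J) (hs_lt J) t ht.1 htT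
      rw [le_div_iff₀ hpos]
      have h2 : tStar - (tStar - (tStar - t₀) / 2 ^ J) = (tStar - t₀) / 2 ^ J := by ring
      rwa [h2] at h
    have hlen : tStar - (tStar - t₀) / 2 ^ (J + 1) - (tStar - (tStar - t₀) / 2 ^ J)
        = ((tStar - t₀) / 2 ^ J) / 2 := by
      rw [pow_succ]
      ring
    calc ∫ t in (tStar - (tStar - t₀) / 2 ^ J)..(tStar - (tStar - t₀) / 2 ^ (J + 1)), f t
        ≤ ∫ _t in (tStar - (tStar - t₀) / 2 ^ J)..(tStar - (tStar - t₀) / 2 ^ (J + 1)),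
            G (tStar - (tStar - t₀) / 2 ^ J) / ((tStar - t₀) / 2 ^ J) :=
          intervalIntegral.integral_mono_on (hmono J) hint2 intervalIntegrable_const hbound
      _ = (1 / 2) * G (tStar - (tStar - t₀) / 2 ^ J) := by
          rw [intervalIntegral.integral_const, smul_eq_mul, hlen]
          field_simp

/-- **A finite set of naturals whose members are pairwise within `D` of each other has at most `D + 1` elements.**
[folklore] -/
theorem card_le_of_pairwise_le {S : Finset ℕ} {D : ℝ} (hD : 0 ≤ D)
    (h : ∀ j ∈ S, ∀ j' ∈ S, (j : ℝ) ≤ j' + D) : (S.card : ℝ) ≤ D + 1 := by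
  rcases S.eq_empty_or_nonempty with hS | hS
  · rw [hS, Finset.card_empty, Nat.cast_zero]
    linarith
  · set m := S.min' hS with hm
    have hsub : S ⊆ Finset.Icc m (m + ⌊D⌋₊) := by
      intro j hj
      rw [Finset.mem_Icc]
      have hmj : m ≤ j := Finset.min'_le S j hj
      refine ⟨hmj, ?_⟩
      have h1 : (j : ℝ) ≤ m + D := h j hj m (Finset.min'_mem S hS)
      have h2 : ((j - m : ℕ) : ℝ) ≤ D := by
        rw [Nat.cast_sub hmj]
        linarith
      have h3 : j - m ≤ ⌊D⌋₊ := Nat.le_floor h2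
      omega
    have hcard := Finset.card_le_card hsub
    rw [Nat.card_Icc] at hcard
    have h4 : m + ⌊D⌋₊ + 1 - m = ⌊D⌋₊ + 1 := by omega
    rw [h4] at hcard
    have h5 : (S.card : ℝ) ≤ ((⌊D⌋₊ + 1 : ℕ) : ℝ) := by exact_mod_cast hcard
    push_cast at h5
    linarith [Nat.floor_le hD]

/-- **Sparse fibres.**  If `P ≥ 0` is summable over `ℤ` and the index map `F : ℕ → ℤ` repeats a value only at indices
within `D` of each other, then `Σ_{j<J} P(k − F j) ≤ (D+1) Σ_n P n`, uniformly in `k` and `J`. [folklore] -/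
theorem sum_le_of_sparse_fibers {P : ℤ → ℝ} (hP0 : ∀ n, 0 ≤ P n) (hP : Summable P)
    {F : ℕ → ℤ} {D : ℝ} (hD : 0 ≤ D) (hF : ∀ j j' : ℕ, F j = F j' → (j : ℝ) ≤ j' + D)
    (k : ℤ) (J : ℕ) :
    ∑ j ∈ Finset.range J, P (k - F j) ≤ (D + 1) * ∑' n, P n := by
  classical
  rw [Finset.sum_comp P (fun j => k - F j)]
  have hfib : ∀ n ∈ (Finset.range J).image (fun j => k - F j),
      (((Finset.range J).filter (fun j => k - F j = n)).card • P n) ≤ (D + 1) * P n := by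
    intro n _
    rw [nsmul_eq_mul]
    refine mul_le_mul_of_nonneg_right (card_le_of_pairwise_le hD fun j hj j' hj' => hF j j' ?_) (hP0 n)
    have h1 := (Finset.mem_filter.1 hj).2
    have h2 := (Finset.mem_filter.1 hj').2
    omega
  calc ∑ n ∈ (Finset.range J).image (fun j => k - F j),
        ((Finset.range J).filter (fun j => k - F j = n)).card • P n
      ≤ ∑ n ∈ (Finset.range J).image (fun j => k - F j), (D + 1) * P n := Finset.sum_le_sum hfib
    _ = (D + 1) * ∑ n ∈ (Finset.range J).image (fun j => k - F j), P n := by rw [Finset.mul_sum]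
    _ ≤ (D + 1) * ∑' n, P n :=
        mul_le_mul_of_nonneg_left (hP.sum_le_tsum _ fun n _ => hP0 n) (by linarith)

/-- **Improper integrability on `[0, t⋆)` from bounded partial integrals.**  A non-negative function continuous on
`[0,t⋆)` whose integrals `∫₀^{b_i} f` stay `≤ I` along anchors `b_i ↑ t⋆` is integrable on `[0,t⋆)` with
`∫_{[0,t⋆)} f ≤ I`. [folklore] -/
theorem integrableOn_Ico_of_intervalIntegral_le {f : ℝ → ℝ} {tStar I : ℝ} (hT : 0 < tStar)
    (hf : ContinuousOn f (Ico 0 tStar)) (hf0 : ∀ t ∈ Ico 0 tStar, 0 ≤ f t)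
    {b : ℕ → ℝ} (hb0 : ∀ i, 0 ≤ b i) (hbT : ∀ i, b i < tStar) (hb : Tendsto b atTop (𝓝 tStar))
    (h : ∀ i, ∫ t in (0 : ℝ)..b i, f t ≤ I) :
    IntegrableOn f (Ico 0 tStar) ∧ ∫ t in Ico 0 tStar, f t ≤ I := by
  have hfi : ∀ i, IntegrableOn f (Ioc 0 (b i)) := fun i =>
    ((hf.mono fun x hx => ⟨hx.1, lt_of_le_of_lt hx.2 (hbT i)⟩).integrableOn_Icc).mono_set
      Ioc_subset_Icc_self
  have hnorm : ∀ i, (∫ t in Ioc 0 (b i), ‖f t‖) ≤ I := by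
    intro i
    have h1 : (∫ t in Ioc 0 (b i), ‖f t‖) = ∫ t in Ioc 0 (b i), f t := by
      refine setIntegral_congr_fun measurableSet_Ioc fun t ht => ?_
      rw [Real.norm_eq_abs, abs_of_nonneg (hf0 t ⟨ht.1.le, lt_of_le_of_lt ht.2 (hbT i)⟩)]
    rw [h1, ← intervalIntegral.integral_of_le (hb0 i)]
    exact h i
  have hIoc : IntegrableOn f (Ioc 0 tStar) :=
    integrableOn_Ioc_of_intervalIntegral_norm_bounded_right (l := atTop) hfi hb
      (Eventually.of_forall hnorm)
  have hIcc : IntegrableOn f (Icc 0 tStar) := by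
    rw [integrableOn_Icc_iff_integrableOn_Ioc]
    exact hIoc
  refine ⟨hIcc.mono_set Ico_subset_Icc_self, ?_⟩
  have hcont : ContinuousOn (fun x => ∫ t in (0 : ℝ)..x, f t) (Icc 0 tStar) := by
    have h1 : IntegrableOn f (uIcc 0 tStar) := by rwa [uIcc_of_le hT.le]
    have h2 := intervalIntegral.continuousOn_primitive_interval (μ := volume) h1
    rwa [uIcc_of_le hT.le] at h2
  have hlim : Tendsto (fun i => ∫ t in (0 : ℝ)..b i, f t) atTop (𝓝 (∫ t in (0 : ℝ)..tStar, f t)) := by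
    have hcw := hcont tStar (right_mem_Icc.2 hT.le)
    have hbin : Tendsto b atTop (𝓝[Icc 0 tStar] tStar) :=
      tendsto_nhdsWithin_iff.2 ⟨hb, Eventually.of_forall fun i => ⟨hb0 i, (hbT i).le⟩⟩
    exact hcw.tendsto.comp hbin
  have hle : ∫ t in (0 : ℝ)..tStar, f t ≤ I := le_of_tendsto' hlim h
  rw [intervalIntegral.integral_of_le hT.le] at hle
  rwa [integral_Ico_eq_integral_Ioo, ← integral_Ioc_eq_integral_Ioo]

/-- **(UA) ⟸ TYPE I + (FE) + (WC∑).**  For a regular `ν`-viscous trajectory blowing up at `t⋆` at the type-I rate, with the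
front a=1 envelope (FE) and wake calming (WC) after every late anchor with a SUMMABLE profile `P : ℤ → ℝ≥0`, the critical
action is uniformly bounded: `Λ^k ∫_{[0,t⋆)} ‖X_k‖ ≤ A` for every shell `k` (and each integrand is integrable).  MODEL lattice only.
[cite: Tao2016AveragedNS, §4 Thm. 4.2 (statement shape), the viscous equation before it, §6.4; cell vocabulary (stmt-NavierStokesRegularity-20420, stub (ω4))] -/
theorem uniformCriticalAction_of_summableWake {R ε₀ ν : ℝ} (hε₀ : 0 < ε₀) (hν : 0 < ν)
    {α : Fin 4 → Fin 4 → Fin 4 → ℤ × ℤ × ℤ → ℝ} (hα : InTableClass R α) {X₀ : Fin 4 → ℝ}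
    {X : Fin 4 → ℤ → ℝ → ℝ} {tStar : ℝ} (hV : ViscousUpTo ε₀ ν α X₀ X tStar) (hB : BlowsUpAt ε₀ X tStar)
    (hT1 : TypeOne ε₀ X tStar)
    (hEnv : ∃ Q t₂ : ℝ, t₂ < tStar ∧ ∀ t : ℝ, 0 ≤ t → t₂ ≤ t → t < tStar → ∀ (i : Fin 4) (F : ℤ),
      1 / (32 * (3 + bigLam ε₀)) ≤ bigLam ε₀ ^ F * |X i F t| * (tStar - t) →
        (1 + ε₀) ^ ((F : ℝ) / 2) * |X i F t| ≤ Q)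
    {P : ℤ → ℝ} (hP0 : ∀ n, 0 ≤ P n) (hPs : Summable P)
    (hWC : ∃ t₃ : ℝ, t₃ < tStar ∧ ∀ ta : ℝ, 0 ≤ ta → t₃ ≤ ta → ta < tStar → ∀ (i : Fin 4) (F : ℤ),
      1 / (32 * (3 + bigLam ε₀)) ≤ bigLam ε₀ ^ F * |X i F ta| * (tStar - ta) →
        ∀ (n : ℤ) (t : ℝ), ta ≤ t → t < tStar →
          bigLam ε₀ ^ (n + F) * (tStar - ta) * ‖shellVec X (n + F) t‖ ≤ P n) :
    ∃ A : ℝ, ∀ k : ℤ, IntegrableOn (fun t => ‖shellVec X k t‖) (Ico 0 tStar) ∧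
      bigLam ε₀ ^ k * (∫ t in Ico 0 tStar, ‖shellVec X k t‖) ≤ A := by
  have hl0 : (0 : ℝ) < 1 + ε₀ := by linarith
  have hε : (-1 : ℝ) < ε₀ := by linarith
  have hΛ : 0 < bigLam ε₀ := bigLam_pos hε
  have hT : 0 < tStar := hV.pos
  set cs : ℝ := 1 / (32 * (3 + bigLam ε₀)) with hcs
  have hcs0 : 0 < cs := by rw [hcs]; positivity
  obtain ⟨K₁, t₁, hK₁, ht₁T, hclock⟩ := frontClock_of_typeOne hε₀ hν hα hV hT1
  obtain ⟨Q, t₂, ht₂T, henv⟩ := hEnv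
  obtain ⟨C₀, hC₀⟩ := hT1
  set C : ℝ := 2 * max C₀ 0 with hCdef
  have hC0 : 0 ≤ C := by rw [hCdef]; positivity
  have htypeI : ∀ (n : ℤ) (t : ℝ), 0 ≤ t → t < tStar →
      bigLam ε₀ ^ n * (tStar - t) * ‖shellVec X n t‖ ≤ C := by
    intro n t ht0 htT
    have hLt : 0 < bigLam ε₀ ^ n * (tStar - t) := mul_pos (zpow_pos hΛ n) (by linarith)
    have hcomp : ∀ j : Fin 4, |X j n t| ≤ max C₀ 0 / (bigLam ε₀ ^ n * (tStar - t)) := by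
      intro j
      rw [le_div_iff₀ hLt]
      calc |X j n t| * (bigLam ε₀ ^ n * (tStar - t)) = bigLam ε₀ ^ n * |X j n t| * (tStar - t) := by ring
        _ ≤ C₀ := hC₀ t ht0 htT j n
        _ ≤ max C₀ 0 := le_max_left _ _
    have h := norm_shellVec_le_two_mul (div_nonneg (le_max_right _ _) hLt.le) hcomp
    have hne : bigLam ε₀ ^ n * (tStar - t) ≠ 0 := hLt.ne'
    calc bigLam ε₀ ^ n * (tStar - t) * ‖shellVec X n t‖
        ≤ bigLam ε₀ ^ n * (tStar - t) * (2 * (max C₀ 0 / (bigLam ε₀ ^ n * (tStar - t)))) :=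
          mul_le_mul_of_nonneg_left h hLt.le
      _ = C := by rw [hCdef, mul_comm (2 : ℝ) _, ← mul_assoc, mul_div_cancel₀ _ hne, mul_comm]
  obtain ⟨t₃, ht₃T, hwc⟩ := hWC
  set t₀ : ℝ := max (max t₁ t₂) (max t₃ 0) with ht₀
  have ht₀T : t₀ < tStar := max_lt (max_lt ht₁T ht₂T) (max_lt ht₃T hT)
  have hgap : 0 < tStar - t₀ := by linarith
  have h0t₀ : 0 ≤ t₀ := (le_max_right _ _).trans (le_max_right _ _)
  have h1t₀ : t₁ ≤ t₀ := (le_max_left _ _).trans (le_max_left _ _)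
  have h2t₀ : t₂ ≤ t₀ := (le_max_right _ _).trans (le_max_left _ _)
  have h3t₀ : t₃ ≤ t₀ := (le_max_left _ _).trans (le_max_right _ _)
  have hfront : ∀ t : ℝ, 0 ≤ t → t < tStar →
      ∃ (i : Fin 4) (F : ℤ), cs ≤ bigLam ε₀ ^ F * |X i F t| * (tStar - t) :=
    fun t ht0 htT => typeOne_quantity_lower_bound hε₀ hν hα hV hB t ht0 htT
  choose! iF FF hFF using hfront
  have hQpos : 0 < Q := by
    have h := henv t₀ h0t₀ h2t₀ ht₀T (iF t₀) (FF t₀) (hFF t₀ h0t₀ ht₀T)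
    have hX : X (iF t₀) (FF t₀) t₀ ≠ 0 := by
      intro h0
      have := hFF t₀ h0t₀ ht₀T
      rw [h0, abs_zero, mul_zero, zero_mul] at this
      exact absurd this (not_le.2 hcs0)
    exact lt_of_lt_of_le (mul_pos (Real.rpow_pos_of_pos hl0 _) (abs_pos.2 hX)) h
  set m₁ : ℝ := cs * ν / Q with hm₁
  have hm₁0 : 0 < m₁ := by rw [hm₁]; positivity
  have hlow : ∀ t : ℝ, t₀ ≤ t → t < tStar → m₁ ≤ ν * (1 + ε₀) ^ ((2 : ℝ) * FF t) * (tStar - t) := by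
    intro t ht htT
    have ht0 : 0 ≤ t := h0t₀.trans ht
    exact lowerClock_of_frontEnvelope hε hν.le hcs0 (hFF t ht0 htT)
      (henv t ht0 (h2t₀.trans ht) htT _ _ (hFF t ht0 htT))
  have hup : ∀ t : ℝ, t₀ ≤ t → t < tStar → ν * (1 + ε₀) ^ ((2 : ℝ) * FF t) * (tStar - t) < K₁ := by
    intro t ht htT
    have ht0 : 0 ≤ t := h0t₀.trans ht
    exact hclock t ht0 (h1t₀.trans ht) htT _ _ (hFF t ht0 htT)
  set s : ℕ → ℝ := fun j => tStar - (tStar - t₀) / 2 ^ j with hsdef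
  have hs_lt : ∀ j : ℕ, s j < tStar := fun j => by
    have : 0 < (tStar - t₀) / 2 ^ j := by positivity
    simp only [hsdef]
    linarith
  have hs_ge : ∀ j : ℕ, t₀ ≤ s j := fun j => by
    have h1 : (tStar - t₀) / 2 ^ j ≤ tStar - t₀ := div_le_self hgap.le (one_le_pow₀ (by norm_num))
    simp only [hsdef]
    linarith
  have hs0 : ∀ j : ℕ, 0 ≤ s j := fun j => h0t₀.trans (hs_ge j)
  have hs_tend : Tendsto s atTop (𝓝 tStar) := by
    have h1 : Tendsto (fun j : ℕ => (tStar - t₀) * (1 / 2 : ℝ) ^ j) atTop (𝓝 ((tStar - t₀) * 0)) :=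
      (tendsto_pow_atTop_nhds_zero_of_lt_one (by norm_num) (by norm_num)).const_mul _
    rw [mul_zero] at h1
    have h2 : Tendsto (fun j : ℕ => tStar - (tStar - t₀) * (1 / 2 : ℝ) ^ j) atTop (𝓝 (tStar - 0)) :=
      h1.const_sub tStar
    rw [sub_zero] at h2
    refine h2.congr fun j => ?_
    show tStar - (tStar - t₀) * (1 / 2 : ℝ) ^ j = tStar - (tStar - t₀) / 2 ^ j
    rw [one_div, inv_pow, div_eq_mul_inv]
  have hlog2 : 0 < Real.log 2 := Real.log_pos (by norm_num)
  have hclose : ∀ j j' : ℕ, FF (s j) = FF (s j') →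
      (j : ℝ) ≤ j' + Real.log (K₁ / m₁) / Real.log 2 := by
    intro j j' hjj
    have hl := hlow (s j) (hs_ge j) (hs_lt j)
    have hu := hup (s j') (hs_ge j') (hs_lt j')
    rw [← hjj] at hu
    set q : ℝ := ν * (1 + ε₀) ^ ((2 : ℝ) * FF (s j)) with hq
    have hq0 : 0 < q := by rw [hq]; exact mul_pos hν (Real.rpow_pos_of_pos hl0 _)
    have hsj : tStar - s j = (tStar - t₀) / 2 ^ j := by simp only [hsdef]; ring
    have hsj' : tStar - s j' = (tStar - t₀) / 2 ^ j' := by simp only [hsdef]; ring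
    rw [hsj] at hl
    rw [hsj'] at hu
    have h2j : (0 : ℝ) < 2 ^ j := by positivity
    have h2j' : (0 : ℝ) < 2 ^ j' := by positivity
    have hA : m₁ * 2 ^ j ≤ q * (tStar - t₀) := by
      have := mul_le_mul_of_nonneg_right hl h2j.le
      rwa [mul_assoc, div_mul_cancel₀ _ h2j.ne'] at this
    have hB' : q * (tStar - t₀) < K₁ * 2 ^ j' := by
      have := mul_lt_mul_of_pos_right hu h2j'
      rwa [mul_assoc, div_mul_cancel₀ _ h2j'.ne'] at this
    have hAB : m₁ * 2 ^ j < K₁ * 2 ^ j' := lt_of_le_of_lt hA hB'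
    have hlogs := Real.log_lt_log (by positivity) hAB
    rw [Real.log_mul hm₁0.ne' h2j.ne', Real.log_mul hK₁.ne' h2j'.ne', Real.log_pow, Real.log_pow] at hlogs
    rw [Real.log_div hK₁.ne' hm₁0.ne']
    rw [← sub_nonneg]
    have : 0 ≤ ((j' : ℝ) + (Real.log K₁ - Real.log m₁) / Real.log 2 - j) * Real.log 2 := by
      have h3 : ((j' : ℝ) + (Real.log K₁ - Real.log m₁) / Real.log 2 - j) * Real.log 2
          = j' * Real.log 2 + (Real.log K₁ - Real.log m₁) - j * Real.log 2 := by
        field_simp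
      rw [h3]
      linarith
    exact nonneg_of_mul_nonneg_left this hlog2
  have hD : 0 ≤ Real.log (K₁ / m₁) / Real.log 2 := by
    have := hclose 0 0 rfl
    simpa using this
  set D : ℝ := Real.log (K₁ / m₁) / Real.log 2 with hDdef
  refine ⟨t₀ * (C / (tStar - t₀)) + (1 / 2) * ((D + 1) * ∑' n, P n), fun k => ?_⟩
  set f : ℝ → ℝ := fun t => bigLam ε₀ ^ k * ‖shellVec X k t‖ with hfdef
  have hLk : 0 < bigLam ε₀ ^ k := zpow_pos hΛ k
  have hfcont : ContinuousOn f (Ico 0 tStar) :=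
    continuousOn_const.mul (continuousOn_shellVec_of_contDiffOn hV.contDiffOn k).norm
  have hf0 : ∀ t ∈ Ico 0 tStar, 0 ≤ f t := fun t _ => mul_nonneg hLk.le (norm_nonneg _)
  have hGk : ∀ s' : ℝ, t₀ ≤ s' → s' < tStar → ∀ t : ℝ, s' ≤ t → t < tStar →
      f t * (tStar - s') ≤ P (k - FF s') := by
    intro s' hs' hs'T t hst htT
    have h0s' : 0 ≤ s' := h0t₀.trans hs'
    have h := hwc s' h0s' (h3t₀.trans hs') hs'T (iF s') (FF s') (hFF s' h0s' hs'T) (k - FF s') t hst htT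
    rw [sub_add_cancel] at h
    calc f t * (tStar - s') = bigLam ε₀ ^ k * (tStar - s') * ‖shellVec X k t‖ := by
          simp only [hfdef]; ring
      _ ≤ P (k - FF s') := h
  have htail : ∀ J : ℕ, ∫ t in t₀..s J, f t ≤ (1 / 2) * ((D + 1) * ∑' n, P n) := by
    intro J
    have h1 := intervalIntegral_le_sum_of_anchored (G := fun s' => P (k - FF s')) ht₀T
      (hfcont.mono fun x hx => ⟨h0t₀.trans hx.1, hx.2⟩) hGk J
    have h2 := sum_le_of_sparse_fibers hP0 hPs hD (F := fun j => FF (s j)) hclose k J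
    exact h1.trans (mul_le_mul_of_nonneg_left h2 (by norm_num))
  have hhead : ∫ t in (0 : ℝ)..t₀, f t ≤ t₀ * (C / (tStar - t₀)) := by
    have hint : IntervalIntegrable f volume 0 t₀ :=
      (hfcont.mono fun x hx => ⟨hx.1, lt_of_le_of_lt hx.2 ht₀T⟩).intervalIntegrable_of_Icc h0t₀
    have hbound : ∀ t ∈ Icc (0 : ℝ) t₀, f t ≤ C / (tStar - t₀) := by
      intro t ht
      have htT : t < tStar := lt_of_le_of_lt ht.2 ht₀T
      have htt : 0 < tStar - t := by linarith
      have h := htypeI k t ht.1 htT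
      rw [le_div_iff₀ hgap]
      calc f t * (tStar - t₀) ≤ f t * (tStar - t) :=
            mul_le_mul_of_nonneg_left (by linarith [ht.2]) (hf0 t ⟨ht.1, htT⟩)
        _ = bigLam ε₀ ^ k * (tStar - t) * ‖shellVec X k t‖ := by simp only [hfdef]; ring
        _ ≤ C := h
    calc ∫ t in (0 : ℝ)..t₀, f t ≤ ∫ _t in (0 : ℝ)..t₀, C / (tStar - t₀) :=
          intervalIntegral.integral_mono_on h0t₀ hint intervalIntegrable_const hbound
      _ = t₀ * (C / (tStar - t₀)) := by rw [intervalIntegral.integral_const, smul_eq_mul, sub_zero]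
  have hpartial : ∀ J : ℕ, ∫ t in (0 : ℝ)..s J, f t ≤
      t₀ * (C / (tStar - t₀)) + (1 / 2) * ((D + 1) * ∑' n, P n) := by
    intro J
    have hint1 : IntervalIntegrable f volume 0 t₀ :=
      (hfcont.mono fun x hx => ⟨hx.1, lt_of_le_of_lt hx.2 ht₀T⟩).intervalIntegrable_of_Icc h0t₀
    have hint2 : IntervalIntegrable f volume t₀ (s J) :=
      (hfcont.mono fun x hx => ⟨h0t₀.trans hx.1, lt_of_le_of_lt hx.2 (hs_lt J)⟩).intervalIntegrable_of_Icc
        (hs_ge J)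
    rw [← intervalIntegral.integral_add_adjacent_intervals hint1 hint2]
    exact add_le_add hhead (htail J)
  obtain ⟨hInt, hle⟩ := integrableOn_Ico_of_intervalIntegral_le hT hfcont hf0 hs0 hs_lt hs_tend hpartial
  have hInt' : IntegrableOn (fun t => ‖shellVec X k t‖) (Ico 0 tStar) := by
    have h : IntegrableOn (fun t => (bigLam ε₀ ^ k)⁻¹ * f t) (Ico 0 tStar) := hInt.const_mul _
    refine h.congr_fun (fun t _ => ?_) measurableSet_Ico
    show (bigLam ε₀ ^ k)⁻¹ * (bigLam ε₀ ^ k * ‖shellVec X k t‖) = ‖shellVec X k t‖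
    rw [inv_mul_cancel_left₀ hLk.ne']
  refine ⟨hInt', ?_⟩
  have heq : bigLam ε₀ ^ k * (∫ t in Ico 0 tStar, ‖shellVec X k t‖) = ∫ t in Ico 0 tStar, f t := by
    simp only [hfdef]
    rw [integral_const_mul]
  rw [heq]
  exact hle

/-- **(ω4) ⟸ (ω3) ∧ (FE) ∧ (WC∑).**  The registered conclusion shape of `stub_eternalLimitViscBdd` —
`∃ ν̂ W, IsEternalVisc ε₀ ν̂ α W ∧ UniformBound W ∧ EternalSurvivingFwd 1 ε₀ W` (indeed `ν̂ > 0` and `‖W_0(0)‖ ≥ 1/(32(3+Λ))`) —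
from `ViscousUpTo ∧ BlowsUpAt ∧ TypeOne`, the front a=1 envelope (FE) and wake calming (WC) with a SUMMABLE profile; the
uniform critical action hypothesis (UA) of the tree's `eternalLimitViscBdd_of_frontData` is discharged by
`uniformCriticalAction_of_summableWake`.  MODEL lattice only; (FE), (WC∑), (ω3) and ⟨20420⟩ remain OPEN.
[cite: Tao2016AveragedNS, §4 Thm. 4.2 (statement shape), the viscous equation before it, §6.4; KochNadirashviliSereginSverak2009, Thm 1.1 ff.; cell vocabulary (stmt-NavierStokesRegularity-20420)] -/
theorem eternalLimitViscBdd_of_summableWake {R ε₀ ν : ℝ} (hε₀ : 0 < ε₀) (hν : 0 < ν)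
    {α : Fin 4 → Fin 4 → Fin 4 → ℤ × ℤ × ℤ → ℝ} (hα : InTableClass R α) {X₀ : Fin 4 → ℝ}
    {X : Fin 4 → ℤ → ℝ → ℝ} {tStar : ℝ} (hV : ViscousUpTo ε₀ ν α X₀ X tStar) (hB : BlowsUpAt ε₀ X tStar)
    (hT1 : TypeOne ε₀ X tStar)
    (hEnv : ∃ Q t₂ : ℝ, t₂ < tStar ∧ ∀ t : ℝ, 0 ≤ t → t₂ ≤ t → t < tStar → ∀ (i : Fin 4) (F : ℤ),
      1 / (32 * (3 + bigLam ε₀)) ≤ bigLam ε₀ ^ F * |X i F t| * (tStar - t) →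
        (1 + ε₀) ^ ((F : ℝ) / 2) * |X i F t| ≤ Q)
    {P : ℤ → ℝ} (hP0 : ∀ n, 0 ≤ P n) (hPs : Summable P)
    (hWC : ∃ t₃ : ℝ, t₃ < tStar ∧ ∀ ta : ℝ, 0 ≤ ta → t₃ ≤ ta → ta < tStar → ∀ (i : Fin 4) (F : ℤ),
      1 / (32 * (3 + bigLam ε₀)) ≤ bigLam ε₀ ^ F * |X i F ta| * (tStar - ta) →
        ∀ (n : ℤ) (t : ℝ), ta ≤ t → t < tStar →
          bigLam ε₀ ^ (n + F) * (tStar - ta) * ‖shellVec X (n + F) t‖ ≤ P n) :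
    ∃ νh : ℝ, 0 < νh ∧ ∃ W : ℤ → ℝ → Em 4,
      IsEternalVisc ε₀ νh α W ∧ UniformBound W ∧ EternalSurvivingFwd 1 ε₀ W ∧
        1 / (32 * (3 + bigLam ε₀)) ≤ ‖W 0 0‖ := by
  obtain ⟨A, hUA⟩ := uniformCriticalAction_of_summableWake hε₀ hν hα hV hB hT1 hEnv hP0 hPs hWC
  exact eternalLimitViscBdd_of_frontData hε₀ hν hα hV hB hT1 hEnv hWC hUA

end Summit.NavierStokesRegularity.NavierStokesRegularity.Theorems.EternalRigidityViscBddOne.UniformAction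

end
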